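/-
Copyright (c) 2026. All rights reserved.
Released under Apache 2.0 license as described in the file LICENSE.
Authors: abc-iut cell, seat abc-iut-L4-t10 (gen 4; geometric `EA` column of [AbsTopIII] Prop 4.2 (i) /
Cor 4.5 — consumer of abc-iut-L4-t12's unconditional (H1′) at finitely punctured planes).
-/
import Literature.AnabelianGeometry.AbsoluteAnabelian.ArchimedeanHolFieldFunctorGeometricPlaneComplTwist
import Literature.AnabelianGeometry.AbsoluteAnabelian.ArchimedeanHolFieldFunctorGeometricTripodCovers
import Literature.AnabelianGeometry.AbsoluteAnabelian.AbsTopIII.AutHolLogFrobeniusCor45FullModelProofs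
import HarnessLib

/-!
# [AbsTopIII] Prop 4.2 (i) / Cor 4.5 at the geometric `EA` of everything finite étale over `ℂ ∖ F`,
# for EVERY finite `F ⊆ ℂ` with two points — no residual hypothesis

S. Mochizuki, *Topics in Absolute Anabelian Geometry III*, proof of Prop. 4.2 (i), kurims p.106 l.11–19;
Cor. 4.5 pp.107–109. [cite: MochizukiAbsTopIII2015, Proposition 4.2 (i) p.106]

PROOF-ONLY consumer (seat abc-iut-L4-t10 gen 4).  abc-iut-L4-t12's
`ArchimedeanHolFieldFunctorGeometricPlaneComplTwist` (`HolRS.isIdRigid_mapsTo_planeComplFinite`) proves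
«objects of `HolRS` mapping to `ℂ ∖ F`» id-rigid for every finite `F` with two distinct points,
UNCONDITIONALLY (puncture double covers transport end parities).  This file reads it through this seat's
geometric Cor 4.5 column (`cor_4_5_geometric`, `isIdRigid_pairs_of_isIdRigid_EA`,
`cor_4_5_full_geometric_iff`), superseding the `|F| = 2` case of
`ArchimedeanHolFieldFunctorGeometricTripodCovers` (`cor_4_5_geometric_planeComplPairCovers`):

* `HolRS.isIdRigid_EA_planeComplCovers` — `EA^hol_RS(Q_{ℂ∖F})` is id-rigid;
* `HolRS.isIdRigid_pairs_planeComplCovers` — Prop 4.2 (i): `𝒞^hol_TF`, `𝒞^hol_T` over it are id-rigid;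
* `HolRS.cor_4_5_geometric_planeComplCovers` — **Cor 4.5 (i)(ii)(iv) + the (iii)-cores and (v) clauses
  AS TYPED (`AbsTopIII.Cor_4_5`)** for the archimedean log-Frobenius data over `EA^hol_RS(Q_{ℂ∖F})`,
  for every finite `F` with two distinct points — ZERO residual hypotheses;
* `HolRS.cor_4_5_full_geometric_planeComplCovers_iff` — there, `Cor_4_5_full` ⟺ the telecore half of
  (iii) (`LogObsCompatTelecoreStmt`).

In particular every hyperbolic curve of genus `0` over `ℂ` (`ℙ¹` minus `≥ 3` points `= ℂ ∖ F`,
`|F| ≥ 2`) is covered.  HONEST SCOPE: model level (OUR `HolRS`); model ≠ reconstruction; support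
library, not a node; nothing here bears on [IUTchIII] Cor. 3.12.  No definitions, no instances, no
named facts.
-/

noncomputable section

open CategoryTheory Set
open Literature.Topology.CoveringSpaces

namespace Literature.AnabelianGeometry.AbsoluteAnabelian

namespace HolRS

variable {F : Set ℂ} (hF : F.Finite)

/-- **`EA^hol_RS(Q_{ℂ∖F})` is id-rigid** for every finite `F ⊆ ℂ` with two distinct points
(abc-iut-L4-t12's `isIdRigid_mapsTo_planeComplFinite`, read as a statement about the `EA` of the
geometric interface datum). [cite: MochizukiAbsTopIII2015, Proposition 4.2 (i) p.106] -/
theorem isIdRigid_EA_planeComplCovers {p₁ p₂ : ℂ} (hp₁ : p₁ ∈ F) (hp₂ : p₂ ∈ F) (hp : p₁ ≠ p₂) :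
    IsIdRigid (geometricAutHolFieldFunctor (fun Y : HolRS =>
      Nonempty (Y ⟶ planeComplFinite F hF))).EA :=
  isIdRigid_mapsTo_planeComplFinite hF hp₁ hp₂ hp

/-- **Prop 4.2 (i): `𝒞^hol_TF` and `𝒞^hol_T` over `EA^hol_RS(Q_{ℂ∖F})` are id-rigid**, every finite `F`
with two distinct points. [cite: MochizukiAbsTopIII2015, Proposition 4.2 (i) p.105] -/
theorem isIdRigid_pairs_planeComplCovers {p₁ p₂ : ℂ} (hp₁ : p₁ ∈ F) (hp₂ : p₂ ∈ F) (hp : p₁ ≠ p₂)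
    {T : ArchPairType} (hT : T.IsMonoidType) :
    IsIdRigid (HolTFPair (geometricAutHolFieldFunctor (fun Y : HolRS =>
      Nonempty (Y ⟶ planeComplFinite F hF)))) ∧
    IsIdRigid (HolMonoidPair (geometricAutHolFieldFunctor (fun Y : HolRS =>
      Nonempty (Y ⟶ planeComplFinite F hF))) T) :=
  isIdRigid_pairs_of_isIdRigid_EA _ (isIdRigid_EA_planeComplCovers hF hp₁ hp₂ hp) hT

/-- **[AbsTopIII] Cor 4.5 (i)(ii)(iv) with the (iii)-cores and (v) clauses AS TYPED (`AbsTopIII.Cor_4_5`)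
for the archimedean log-Frobenius data over `EA^hol_RS(Q_{ℂ∖F})`**, for EVERY finite `F ⊆ ℂ` with two
distinct points — no residual hypothesis (object `𝕏₀ := ℂ ∖ F`).
[cite: MochizukiAbsTopIII2015, Corollary 4.5 pp.107–109] -/
theorem cor_4_5_geometric_planeComplCovers {p₁ p₂ : ℂ} (hp₁ : p₁ ∈ F) (hp₂ : p₂ ∈ F) (hp : p₁ ≠ p₂) :
    AbsTopIII.Cor_4_5
      (archLogFrobeniusData (geometricAutHolFieldFunctor (fun Y : HolRS =>
        Nonempty (Y ⟶ planeComplFinite F hF))))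
      (archTelecoreData (geometricAutHolFieldFunctor (fun Y : HolRS =>
        Nonempty (Y ⟶ planeComplFinite F hF)))) :=
  cor_4_5_geometric _ ⟨planeComplFinite F hF, ⟨𝟙 _⟩⟩ (isIdRigid_EA_planeComplCovers hF hp₁ hp₂ hp)

/-- **`Cor_4_5_full` over `EA^hol_RS(Q_{ℂ∖F})` ⟺ the telecore half of (iii)** (`LogObsCompatTelecoreStmt`),
every finite `F` with two distinct points. [cite: MochizukiAbsTopIII2015, Corollary 4.5 pp.107–109] -/
theorem cor_4_5_full_geometric_planeComplCovers_iff {p₁ p₂ : ℂ} (hp₁ : p₁ ∈ F) (hp₂ : p₂ ∈ F)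
    (hp : p₁ ≠ p₂) :
    AbsTopIII.Cor_4_5_full
        (archLogFrobeniusData (geometricAutHolFieldFunctor (fun Y : HolRS =>
          Nonempty (Y ⟶ planeComplFinite F hF))))
        (archTelecoreData (geometricAutHolFieldFunctor (fun Y : HolRS =>
          Nonempty (Y ⟶ planeComplFinite F hF)))) ↔
      (archLogFrobeniusData (geometricAutHolFieldFunctor (fun Y : HolRS =>
          Nonempty (Y ⟶ planeComplFinite F hF)))).LogObsCompatTelecoreStmt
        (archTelecoreData (geometricAutHolFieldFunctor (fun Y : HolRS =>
          Nonempty (Y ⟶ planeComplFinite F hF)))) :=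
  cor_4_5_full_geometric_iff _ ⟨planeComplFinite F hF, ⟨𝟙 _⟩⟩
    (isIdRigid_EA_planeComplCovers hF hp₁ hp₂ hp)

/-- **The `ncard` form**: Cor 4.5 AS TYPED over `EA^hol_RS(Q_{ℂ∖F})` for every finite `F` with
`2 ≤ |F|`. [cite: MochizukiAbsTopIII2015, Corollary 4.5 pp.107–109] -/
theorem cor_4_5_geometric_planeComplCovers_of_two_le_ncard (h2 : 2 ≤ F.ncard) :
    AbsTopIII.Cor_4_5
      (archLogFrobeniusData (geometricAutHolFieldFunctor (fun Y : HolRS =>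
        Nonempty (Y ⟶ planeComplFinite F hF))))
      (archTelecoreData (geometricAutHolFieldFunctor (fun Y : HolRS =>
        Nonempty (Y ⟶ planeComplFinite F hF)))) := by
  obtain ⟨p₁, hp₁, p₂, hp₂, hp⟩ := (Set.one_lt_ncard hF).mp (by omega)
  exact cor_4_5_geometric_planeComplCovers hF hp₁ hp₂ hp

end HolRS

end Literature.AnabelianGeometry.AbsoluteAnabelian

-- re-land (comment only, 14:53Z): regain the check-farm olean (tree-health rule of thumb, stranded ≥ 30 min).
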